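import Summits.QuantumFields.BalabanUV.Beta.FP.RelInvPeriodisedComb
import Summits.QuantumFields.BalabanUV.Beta.FP.RelInvPeriodisedChartEffForm

/-!
# `BalabanUV.Beta.FP.RelInvPeriodisedCombRecord` — road «FP» (binder row D1), ROUTE T row **(T-INV)** AT THE CHART OF RECORD (III′), the (J-a) dictionary's
# item **(γ-sym)**, TORUS HALF: **binder `h1`, the (INV)-2 transfer, (E) the `μμ` block of the effective form, (ID) `hId` at order 0 and (H2) the second (INV)
# letter FOR THE CHART-(III′) TRIPLE `(GcombSh Lc j, bhKStepSh d Lc (Dsh Lc) j, axEc ρ_c Lc)`** at the index types of record — the suppliers of the `h1 ∕ h2 ∕ hId`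
# sockets of the graded door at the sym tables (leaf-02's (β) `…RowsGradedLevelZeroSym`), every `d`, every `Lc ≥ 1`, EVERY level `j`, every box with `Lc ∣ M_i`

HONEST DEPENDENCY (page 1, mandatory): continuum YM on T⁴ ⇐ BetaPertH ∧ nine spine estimates (0/9 proved); BetaPertH ⇐ (D1) ∧ (D4) ∧
CAP+tail; G-an2-4 gates asym, D1 and NE2/3/4.  HONEST FRAMING (cell contract, verbatim): «discharging `BetaPertH` makes Bałaban's UV
stability UNCONDITIONAL — a real constructive-QFT result; it is NOT the continuum limit and NOT the Clay problem.»  ABSOLUTE RULE (cell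
charter, verbatim): «No internally-minted statement may enter as a cited fact. Every hypothesis is either kernel-proved in this package or a
verbatim quotation of a PUBLISHED theorem with page reference. The manuscript(s) under audit are NOT citable for their own disputed steps — they
are the thing under adjudication; programme-internal (2001/route/tribunal) claims are never citable.»

CONTENT = the chart-generic theorems of `RelInvPeriodisedChartCombRows` ∕ `RelInvPeriodisedChartEffForm` at the seven letters of `RelInvPeriodisedComb` (§2–§3) and its
reading letters (iv) `GcombSh_coarse_inr_inr_eq_E2`, (v) `bhKStepSh_succ_inl_inl` (`w = wVH d Lc (j+1)`): `torus_isUnit_det_kkt_combRows_comb` (+ `_coarseSites`),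
`coarse_det_kkt_ne_zero_record_comb`, `effForm_toBlocks₁₁_comb` (`= (perF M (GcombSh Lc j))∘(fμ, fμ)`), `hId_order_zero_comb` ∕ `hId_order_zero_record_comb`
(`= (wVH d Lc (j+1))⁻¹ • (perF M′ (bhKStepSh d Lc (Dsh Lc) (j+1)))∘(fields, fields)`), `torus_h2_comb` ∕ `torus_h2_record_comb`.  Root offset `ctrOff (d+1) Lc`
(`ctr (d+1) Lc = toSite (ctrOff (d+1) Lc)` by `rfl`), so leaf-06's comb rows and residual parameters are `combRowsT (ctr (d+1) Lc) Lc M`, `Res (ctr (d+1) Lc) Lc M`.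
The `minOp ∕ minOpL ∕ flucCov` identifications are in the sequel `FP/RelInvPeriodisedCombMinOp`.  [folklore] one-line instances; nothing of an1's ∕ an2's ∕ leaf-02's ∕
leaf-03's ∕ leaf-06's restated; no `Prop`, no `def`, nothing cited, 0 sorry; discharges NO binder of row D1; NOT (J-a) (the identification of the door's slots with these
objects is the dictionary's), NOT (T-ID), NOT SDF, NOT D1, NOT BetaPertH, NOT continuum, NOT Clay; 0 estimates.  Unit `b2b-balaban-beta-d1-formalise-leaf-05`
(gen 29), 2026-08-22; no existing file touched.
-/

noncomputable section

open scoped BigOperators Matrix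

namespace Summit.QuantumFields.BalabanUV.Beta.FP.RelInvPeriodisedCombRecord

open Matrix
open Literature.Probability.LatticeModels (Torus.proj)
open Literature.MathematicalPhysics.QuantumFieldTheory.Balaban1983to89
open Literature.MathematicalPhysics.QuantumFieldTheory.Balaban1983to89.Beta
open Literature.MathematicalPhysics.QuantumFieldTheory.Balaban1983to89.Beta.Composition (kkt)
open Literature.MathematicalPhysics.QuantumFieldTheory.Balaban1983to89.Beta.CompositionSingular (effForm)
open B5Prop11Plancherel (fine)
open B6Lemma24Torus (pbox)
open ExpKernelCalculus (MKer)
open AffineAveraging (Site box toSite)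
open AveragingContoursRooted (ctr ctrOff ctrOff_mem_box)
open OneStepResolventKernel (Fib)
open BalabanStepJetsSucc (E2 wVH)
open Summit.QuantumFields.BalabanUV.Beta.AxialDressingRooted (axEc one_le_of_neZero)
open Summit.QuantumFields.BalabanUV.Beta.SymShiftedSpread (bhKStepSh)
open Summit.QuantumFields.BalabanUV.Beta.DshAn1 (Dsh)
open Summit.QuantumFields.BalabanUV.Beta.CombChartStepJets (GcombSh)
open Summit.QuantumFields.BalabanUV.Beta.FP.KernelPeriodisationFib (Idx perF)
open Summit.QuantumFields.BalabanUV.Beta.FP.TorusCombRows (Res combRowsT)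
open Summit.QuantumFields.BalabanUV.Beta.FP.RelInvPeriodisedEffFormCoarse (wVH_pos)
open Summit.QuantumFields.BalabanUV.Beta.FP.RelInvPeriodisedComb (spr_bhKStepSh_Dsh shiftK_GcombSh' shiftK_bhKStepSh relInv_GcombSh_bhKStepSh
  bhKStepSh_inr_inr bhKStepSh_inl_inr_eq_neg GcombSh_coarse_inr_inr_eq_E2 bhKStepSh_succ_inl_inl)
open Summit.QuantumFields.BalabanUV.Beta.CombChartContactFactor (spr_GcombSh)
open Summit.QuantumFields.BalabanUV.Beta.FP.RelInvPeriodisedChartCombRows (torus_isUnit_det_kkt_combRows_of_relInv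
  torus_isUnit_det_kkt_combRows_coarseSites_of_relInv coarse_det_kkt_ne_zero_record_of_relInv)
open Summit.QuantumFields.BalabanUV.Beta.FP.RelInvPeriodisedChartEffForm (effForm_toBlocks₁₁_of_relInv hId_order_zero_of_relInv torus_h2_of_relInv)

variable {d : ℕ} {Lc : ℕ} [NeZero Lc]

/-! ## §1 Binder `h1` and the (INV)-2 transfer for chart (III′) -/

section H1

variable (M : Fin (d + 1) → ℕ) [∀ μ, NeZero (M μ)]

set_option synthInstance.maxSize 1024 in
/-- **[folklore] `h1` FOR CHART (III′), ANY coarse presentation.**  Fine bonds = the field slots; coarse multipliers by any injective `inr`-valued `fμ` onto the multiplier slots at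
the `Lc`-coarse sites (`hcoarse`); `τ₁ := combRowsT (ctr (d+1) Lc) Lc M` on the field slots; `M̂′ := perF M (bhKStepSh d Lc (Dsh Lc) j)`.  Every level `j`, every box `M` with
`Lc ∣ M_i`: `IsUnit (kkt (M̂′∘(fields,fields)) [M̂′∘(fμ,fields); τ₁]).det`. -/
theorem torus_isUnit_det_kkt_combRows_comb (hM : ∀ i, Lc ∣ M i) (j : ℕ)
    {μ : Type*} [Fintype μ] [DecidableEq μ] (fμ : μ → Idx M (Fib d)) (hfμ : Function.Injective fμ)
    (hμ : ∀ a : μ, ∃ m : Fin (d + 1), (fμ a).2 = Sum.inr m)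
    (hcoarse : ∀ (s : ↥(pbox M)) (m : Fin (d + 1)), ((s, Sum.inr m) : Idx M (Fib d)) ∈ Set.range fμ ↔ Torus.proj Lc (s : Site (d + 1)) = 0) :
    IsUnit (kkt
      ((perF M (bhKStepSh d Lc (Dsh Lc) j)).submatrix (fun b : ↥(pbox M) × Fin (d + 1) => ((b.1, Sum.inl b.2) : Idx M (Fib d)))
        (fun b : ↥(pbox M) × Fin (d + 1) => ((b.1, Sum.inl b.2) : Idx M (Fib d))))
      (fromRows
        ((perF M (bhKStepSh d Lc (Dsh Lc) j)).submatrix fμ (fun b : ↥(pbox M) × Fin (d + 1) => ((b.1, Sum.inl b.2) : Idx M (Fib d))))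
        ((combRowsT (ctr (d + 1) Lc) Lc M).submatrix id (fun b : ↥(pbox M) × Fin (d + 1) => ((b.1, Sum.inl b.2) : Idx M (Fib d)))))).det :=
  torus_isUnit_det_kkt_combRows_of_relInv M (ctrOff_mem_box (one_le_of_neZero Lc)) hM (spr_GcombSh j) (spr_bhKStepSh_Dsh j) (shiftK_GcombSh' j)
    (fun t => shiftK_bhKStepSh t j) (relInv_GcombSh_bhKStepSh j) (bhKStepSh_inr_inr j) (bhKStepSh_inl_inr_eq_neg j) fμ hfμ hμ hcoarse

set_option synthInstance.maxSize 1024 in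
/-- [folklore] `h1` for chart (III′), the coarse multipliers presented by the COARSE-SITE subtype `(s, m) ↦ (s, inr m)`, `Torus.proj Lc s̃ = 0`. -/
theorem torus_isUnit_det_kkt_combRows_coarseSites_comb (hM : ∀ i, Lc ∣ M i) (j : ℕ) :
    IsUnit (kkt
      ((perF M (bhKStepSh d Lc (Dsh Lc) j)).submatrix (fun b : ↥(pbox M) × Fin (d + 1) => ((b.1, Sum.inl b.2) : Idx M (Fib d)))
        (fun b : ↥(pbox M) × Fin (d + 1) => ((b.1, Sum.inl b.2) : Idx M (Fib d))))
      (fromRows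
        ((perF M (bhKStepSh d Lc (Dsh Lc) j)).submatrix
          (fun a : {s : ↥(pbox M) // Torus.proj Lc (s : Site (d + 1)) = 0} × Fin (d + 1) => ((a.1.1, Sum.inr a.2) : Idx M (Fib d)))
          (fun b : ↥(pbox M) × Fin (d + 1) => ((b.1, Sum.inl b.2) : Idx M (Fib d))))
        ((combRowsT (ctr (d + 1) Lc) Lc M).submatrix id (fun b : ↥(pbox M) × Fin (d + 1) => ((b.1, Sum.inl b.2) : Idx M (Fib d)))))).det :=
  torus_isUnit_det_kkt_combRows_coarseSites_of_relInv M (ctrOff_mem_box (one_le_of_neZero Lc)) hM (spr_GcombSh j) (spr_bhKStepSh_Dsh j) (shiftK_GcombSh' j)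
    (fun t => shiftK_bhKStepSh t j) (relInv_GcombSh_bhKStepSh j) (bhKStepSh_inr_inr j) (bhKStepSh_inl_inr_eq_neg j)

set_option synthInstance.maxSize 1024 in
/-- **[folklore] (INV)-2 AS A TRANSFER FOR CHART (III′), AT THE INDEX TYPES OF RECORD**: on the coarse box `M′` (`Lc ∣ M′_i`), level `k`, coarse one-step rows by any injective `fμ′`
(`hμ′ hcoarse′`): IF `F = c • M̂′_k∘(fields, fields)` (`c ≠ 0`), `hQ`, `hτ` THEN `det kkt F [Q₂₀; τ₂] ≠ 0`.  The consumer feeds `F := S.toBlocks₁₁ (+ G₀)`, `k := j + 1`,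
`c := (wVH (j+1))⁻¹` with `hId := hId_order_zero_record_comb`. -/
theorem coarse_det_kkt_ne_zero_record_comb (M' : Fin (d + 1) → ℕ) [∀ i, NeZero (M' i)] (hM' : ∀ i, Lc ∣ M' i) (k : ℕ)
    {κ : Type*} [Fintype κ] [DecidableEq κ] (fμ' : κ → Idx M' (Fib d)) (hfμ' : Function.Injective fμ')
    (hμ' : ∀ a : κ, ∃ m : Fin (d + 1), (fμ' a).2 = Sum.inr m)
    (hcoarse' : ∀ (s : ↥(pbox M')) (m : Fin (d + 1)), ((s, Sum.inr m) : Idx M' (Fib d)) ∈ Set.range fμ' ↔ Torus.proj Lc (s : Site (d + 1)) = 0)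
    {c : ℝ} (hc : c ≠ 0)
    {F : Matrix (↥(pbox M') × Fin (d + 1)) (↥(pbox M') × Fin (d + 1)) ℝ} {Q₂₀ : Matrix κ (↥(pbox M') × Fin (d + 1)) ℝ}
    {τ₂ : Matrix (Res (ctr (d + 1) Lc) Lc M') (↥(pbox M') × Fin (d + 1)) ℝ}
    (hId : F = c • (perF M' (bhKStepSh d Lc (Dsh Lc) k)).submatrix
      (fun b : ↥(pbox M') × Fin (d + 1) => ((b.1, Sum.inl b.2) : Idx M' (Fib d))) (fun b : ↥(pbox M') × Fin (d + 1) => ((b.1, Sum.inl b.2) : Idx M' (Fib d))))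
    (hQ : Q₂₀ = (perF M' (bhKStepSh d Lc (Dsh Lc) k)).submatrix fμ' (fun b : ↥(pbox M') × Fin (d + 1) => ((b.1, Sum.inl b.2) : Idx M' (Fib d))))
    (hτ : τ₂ = (combRowsT (ctr (d + 1) Lc) Lc M').submatrix id (fun b : ↥(pbox M') × Fin (d + 1) => ((b.1, Sum.inl b.2) : Idx M' (Fib d)))) :
    (kkt F (fromRows Q₂₀ τ₂)).det ≠ 0 :=
  coarse_det_kkt_ne_zero_record_of_relInv M' (ctrOff_mem_box (one_le_of_neZero Lc)) hM' (spr_GcombSh k) (spr_bhKStepSh_Dsh k) (shiftK_GcombSh' k)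
    (fun t => shiftK_bhKStepSh t k) (relInv_GcombSh_bhKStepSh k) (bhKStepSh_inr_inr k) (bhKStepSh_inl_inr_eq_neg k) fμ' hfμ' hμ' hcoarse' hc hId hQ hτ

end H1

/-! ## §2 (E), (ID), (H2) for chart (III′) -/

section EffForm

variable (M : Fin (d + 1) → ℕ) [∀ μ, NeZero (M μ)]

set_option synthInstance.maxSize 1024 in
/-- **[folklore] (E) FOR CHART (III′): THE `μμ` BLOCK OF THE EFFECTIVE FORM OF THE COMB-SLICED PERIODISED LEVEL-`j` SYSTEM IS THE PERIODISED MULTIPLIER BLOCK OF THE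
COMB-CHART RESOLVENT** — `(effForm H₀ [Q₁₀; τ₁]).toBlocks₁₁ = (perF M (GcombSh Lc j))∘(fμ, fμ)` (presentation of record; any injective `inr`-valued `fμ` with `hcoarse`). -/
theorem effForm_toBlocks₁₁_comb (hM : ∀ i, Lc ∣ M i) (j : ℕ)
    {μ : Type*} [Fintype μ] [DecidableEq μ] (fμ : μ → Idx M (Fib d)) (hfμ : Function.Injective fμ)
    (hμ : ∀ a : μ, ∃ m : Fin (d + 1), (fμ a).2 = Sum.inr m)
    (hcoarse : ∀ (s : ↥(pbox M)) (m : Fin (d + 1)), ((s, Sum.inr m) : Idx M (Fib d)) ∈ Set.range fμ ↔ Torus.proj Lc (s : Site (d + 1)) = 0) :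
    (effForm ((perF M (bhKStepSh d Lc (Dsh Lc) j)).submatrix (fun b : ↥(pbox M) × Fin (d + 1) => ((b.1, Sum.inl b.2) : Idx M (Fib d)))
          (fun b : ↥(pbox M) × Fin (d + 1) => ((b.1, Sum.inl b.2) : Idx M (Fib d))))
        (fromRows
          ((perF M (bhKStepSh d Lc (Dsh Lc) j)).submatrix fμ (fun b : ↥(pbox M) × Fin (d + 1) => ((b.1, Sum.inl b.2) : Idx M (Fib d))))
          ((combRowsT (ctr (d + 1) Lc) Lc M).submatrix id (fun b : ↥(pbox M) × Fin (d + 1) => ((b.1, Sum.inl b.2) : Idx M (Fib d)))))).toBlocks₁₁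
      = (perF M (GcombSh (d := d) Lc j)).submatrix fμ fμ :=
  effForm_toBlocks₁₁_of_relInv M (ctrOff_mem_box (one_le_of_neZero Lc)) hM (spr_GcombSh j) (spr_bhKStepSh_Dsh j) (shiftK_GcombSh' j)
    (fun t => shiftK_bhKStepSh t j) (relInv_GcombSh_bhKStepSh j) (bhKStepSh_inr_inr j) (bhKStepSh_inl_inr_eq_neg j) fμ hfμ hμ hcoarse

end EffForm

section Identification

variable (M' : Fin (d + 1) → ℕ) [∀ i, NeZero (M' i)]

set_option synthInstance.maxSize 1024 in
/-- **[folklore] (ID) `hId` AT ORDER 0 FOR CHART (III′), AS A THEOREM.**  On the fine box `fine Lc M′` at level `j`, coarse multipliers by any injective `inr`-valued `fμ` whose range is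
the multiplier slots at the `Lc`-coarse points (`hcoarse`), reading those points through `g` (`hg`):
`(effForm H₀ [Q₁₀; τ₁]).toBlocks₁₁ = (wVH d Lc (j+1))⁻¹ • (perF M′ (bhKStepSh d Lc (Dsh Lc) (j+1)))∘(fields∘g, fields∘g)` (letters (iv) `GcombSh_coarse_inr_inr_eq_E2`, (v) `bhKStepSh_succ_inl_inl`). -/
theorem hId_order_zero_comb (j : ℕ)
    {μ : Type*} [Fintype μ] [DecidableEq μ] (fμ : μ → Idx (fine Lc M') (Fib d)) (hfμ : Function.Injective fμ)
    (hμ : ∀ a : μ, ∃ m : Fin (d + 1), (fμ a).2 = Sum.inr m)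
    (hcoarse : ∀ (s : ↥(pbox (fine Lc M'))) (m : Fin (d + 1)),
      ((s, Sum.inr m) : Idx (fine Lc M') (Fib d)) ∈ Set.range fμ ↔ Torus.proj Lc (s : Site (d + 1)) = 0)
    (g : μ → ↥(pbox M') × Fin (d + 1))
    (hg : ∀ a, ((fμ a).1 : Site (d + 1)) = (Lc : ℤ) • ((g a).1 : Site (d + 1)) ∧ (fμ a).2 = Sum.inr (g a).2) :
    (effForm ((perF (fine Lc M') (bhKStepSh d Lc (Dsh Lc) j)).submatrix
          (fun b : ↥(pbox (fine Lc M')) × Fin (d + 1) => ((b.1, Sum.inl b.2) : Idx (fine Lc M') (Fib d)))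
          (fun b : ↥(pbox (fine Lc M')) × Fin (d + 1) => ((b.1, Sum.inl b.2) : Idx (fine Lc M') (Fib d))))
        (fromRows
          ((perF (fine Lc M') (bhKStepSh d Lc (Dsh Lc) j)).submatrix fμ
            (fun b : ↥(pbox (fine Lc M')) × Fin (d + 1) => ((b.1, Sum.inl b.2) : Idx (fine Lc M') (Fib d))))
          ((combRowsT (ctr (d + 1) Lc) Lc (fine Lc M')).submatrix id
            (fun b : ↥(pbox (fine Lc M')) × Fin (d + 1) => ((b.1, Sum.inl b.2) : Idx (fine Lc M') (Fib d)))))).toBlocks₁₁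
      = (wVH d Lc (j + 1))⁻¹ • (perF M' (bhKStepSh d Lc (Dsh Lc) (j + 1))).submatrix
          (fun a : μ => (((g a).1, Sum.inl (g a).2) : Idx M' (Fib d))) (fun a : μ => (((g a).1, Sum.inl (g a).2) : Idx M' (Fib d))) :=
  hId_order_zero_of_relInv M' (ctrOff_mem_box (one_le_of_neZero Lc)) (spr_GcombSh j) (spr_bhKStepSh_Dsh j) (shiftK_GcombSh' j)
    (fun t => shiftK_bhKStepSh t j) (relInv_GcombSh_bhKStepSh j) (bhKStepSh_inr_inr j) (bhKStepSh_inl_inr_eq_neg j)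
    (GcombSh_coarse_inr_inr_eq_E2 j) (bhKStepSh_succ_inl_inl j) (wVH_pos (d := d) (Nat.pos_of_ne_zero (NeZero.ne Lc)) (j + 1)).ne'
    fμ hfμ hμ hcoarse g hg

set_option synthInstance.maxSize 1024 in
/-- **[folklore] (ID) FOR CHART (III′) AT THE INDEX TYPES OF RECORD** (coarse multipliers by `(p̄, κ) ↦ (cp p̄, inr κ)`, `cp p̄ = Lc • p̄` — gan24-leaf-05's `coarsePt`):
`(effForm H₀ [Q₁₀;τ₁]).toBlocks₁₁ = (wVH d Lc (j+1))⁻¹ • (perF M′ (bhKStepSh d Lc (Dsh Lc) (j+1)))∘(fields, fields)`. -/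
theorem hId_order_zero_record_comb (j : ℕ)
    (cp : ↥(pbox M') → ↥(pbox (fine Lc M'))) (hcp : ∀ p : ↥(pbox M'), (cp p : Site (d + 1)) = (Lc : ℤ) • (p : Site (d + 1)))
    (hfμ : Function.Injective (fun a : ↥(pbox M') × Fin (d + 1) => ((cp a.1, Sum.inr a.2) : Idx (fine Lc M') (Fib d))))
    (hcoarse : ∀ (s : ↥(pbox (fine Lc M'))) (m : Fin (d + 1)),
      ((s, Sum.inr m) : Idx (fine Lc M') (Fib d)) ∈ Set.range (fun a : ↥(pbox M') × Fin (d + 1) => ((cp a.1, Sum.inr a.2) : Idx (fine Lc M') (Fib d)))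
        ↔ Torus.proj Lc (s : Site (d + 1)) = 0) :
    (effForm ((perF (fine Lc M') (bhKStepSh d Lc (Dsh Lc) j)).submatrix
          (fun b : ↥(pbox (fine Lc M')) × Fin (d + 1) => ((b.1, Sum.inl b.2) : Idx (fine Lc M') (Fib d)))
          (fun b : ↥(pbox (fine Lc M')) × Fin (d + 1) => ((b.1, Sum.inl b.2) : Idx (fine Lc M') (Fib d))))
        (fromRows
          ((perF (fine Lc M') (bhKStepSh d Lc (Dsh Lc) j)).submatrix
            (fun a : ↥(pbox M') × Fin (d + 1) => ((cp a.1, Sum.inr a.2) : Idx (fine Lc M') (Fib d)))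
            (fun b : ↥(pbox (fine Lc M')) × Fin (d + 1) => ((b.1, Sum.inl b.2) : Idx (fine Lc M') (Fib d))))
          ((combRowsT (ctr (d + 1) Lc) Lc (fine Lc M')).submatrix id
            (fun b : ↥(pbox (fine Lc M')) × Fin (d + 1) => ((b.1, Sum.inl b.2) : Idx (fine Lc M') (Fib d)))))).toBlocks₁₁
      = (wVH d Lc (j + 1))⁻¹ • (perF M' (bhKStepSh d Lc (Dsh Lc) (j + 1))).submatrix
          (fun b : ↥(pbox M') × Fin (d + 1) => ((b.1, Sum.inl b.2) : Idx M' (Fib d))) (fun b : ↥(pbox M') × Fin (d + 1) => ((b.1, Sum.inl b.2) : Idx M' (Fib d))) :=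
  hId_order_zero_comb M' j (fun a : ↥(pbox M') × Fin (d + 1) => ((cp a.1, Sum.inr a.2) : Idx (fine Lc M') (Fib d))) hfμ (fun a => ⟨a.2, rfl⟩) hcoarse id
    (fun a => ⟨hcp a.1, rfl⟩)

set_option synthInstance.maxSize 1024 in
/-- **[folklore] (H2) THE SECOND (INV) LETTER FOR CHART (III′), AS A THEOREM** (both boxes in chart (III′): level `j` on `fine Lc M′`, level `j + 1` on `M′`; roots `ρ_c`):
`g` BIJECTIVE, `Lc ∣ M′_i`, coarse one-step rows by any injective `fμ′` (`hμ′ hcoarse′`):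
`det kkt ((effForm H₀ [Q₁₀;τ₁]).toBlocks₁₁) [M̂′_{j+1}∘(fμ′, fields∘g); combRowsT (ctr (d+1) Lc) Lc M′∘(·, fields∘g)] ≠ 0`. -/
theorem torus_h2_comb (j : ℕ) (hM' : ∀ i, Lc ∣ M' i)
    {μ : Type*} [Fintype μ] [DecidableEq μ] (fμ : μ → Idx (fine Lc M') (Fib d)) (hfμ : Function.Injective fμ)
    (hμ : ∀ a : μ, ∃ m : Fin (d + 1), (fμ a).2 = Sum.inr m)
    (hcoarse : ∀ (s : ↥(pbox (fine Lc M'))) (m : Fin (d + 1)),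
      ((s, Sum.inr m) : Idx (fine Lc M') (Fib d)) ∈ Set.range fμ ↔ Torus.proj Lc (s : Site (d + 1)) = 0)
    (g : μ → ↥(pbox M') × Fin (d + 1))
    (hg : ∀ a, ((fμ a).1 : Site (d + 1)) = (Lc : ℤ) • ((g a).1 : Site (d + 1)) ∧ (fμ a).2 = Sum.inr (g a).2)
    (hgb : Function.Bijective g)
    {κ : Type*} [Fintype κ] [DecidableEq κ] (fμ' : κ → Idx M' (Fib d)) (hfμ' : Function.Injective fμ')
    (hμ' : ∀ a : κ, ∃ m : Fin (d + 1), (fμ' a).2 = Sum.inr m)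
    (hcoarse' : ∀ (s : ↥(pbox M')) (m : Fin (d + 1)), ((s, Sum.inr m) : Idx M' (Fib d)) ∈ Set.range fμ' ↔ Torus.proj Lc (s : Site (d + 1)) = 0) :
    (kkt
      (effForm ((perF (fine Lc M') (bhKStepSh d Lc (Dsh Lc) j)).submatrix
            (fun b : ↥(pbox (fine Lc M')) × Fin (d + 1) => ((b.1, Sum.inl b.2) : Idx (fine Lc M') (Fib d)))
            (fun b : ↥(pbox (fine Lc M')) × Fin (d + 1) => ((b.1, Sum.inl b.2) : Idx (fine Lc M') (Fib d))))
          (fromRows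
            ((perF (fine Lc M') (bhKStepSh d Lc (Dsh Lc) j)).submatrix fμ
              (fun b : ↥(pbox (fine Lc M')) × Fin (d + 1) => ((b.1, Sum.inl b.2) : Idx (fine Lc M') (Fib d))))
            ((combRowsT (ctr (d + 1) Lc) Lc (fine Lc M')).submatrix id
              (fun b : ↥(pbox (fine Lc M')) × Fin (d + 1) => ((b.1, Sum.inl b.2) : Idx (fine Lc M') (Fib d)))))).toBlocks₁₁
      (fromRows
        ((perF M' (bhKStepSh d Lc (Dsh Lc) (j + 1))).submatrix fμ' (fun a : μ => (((g a).1, Sum.inl (g a).2) : Idx M' (Fib d))))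
        ((combRowsT (ctr (d + 1) Lc) Lc M').submatrix (Equiv.refl _) (fun a : μ => (((g a).1, Sum.inl (g a).2) : Idx M' (Fib d)))))).det ≠ 0 :=
  torus_h2_of_relInv M' (ctrOff_mem_box (one_le_of_neZero Lc)) (spr_GcombSh j) (spr_bhKStepSh_Dsh j) (shiftK_GcombSh' j)
    (fun t => shiftK_bhKStepSh t j) (relInv_GcombSh_bhKStepSh j) (bhKStepSh_inr_inr j) (bhKStepSh_inl_inr_eq_neg j)
    (GcombSh_coarse_inr_inr_eq_E2 j) (bhKStepSh_succ_inl_inl j) (wVH_pos (d := d) (Nat.pos_of_ne_zero (NeZero.ne Lc)) (j + 1)).ne'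
    (ctrOff_mem_box (one_le_of_neZero Lc)) hM' (spr_GcombSh (j + 1)) (spr_bhKStepSh_Dsh (j + 1)) (shiftK_GcombSh' (j + 1))
    (fun t => shiftK_bhKStepSh t (j + 1)) (relInv_GcombSh_bhKStepSh (j + 1)) (bhKStepSh_inr_inr (j + 1)) (bhKStepSh_inl_inr_eq_neg (j + 1))
    fμ hfμ hμ hcoarse g hg hgb fμ' hfμ' hμ' hcoarse'

set_option synthInstance.maxSize 1024 in
/-- **[folklore] (H2) FOR CHART (III′) AT THE INDEX TYPES OF RECORD** (`μ := ↥(pbox M′) × Fin (d+1)`, coarse multipliers by `(p̄, κ) ↦ (cp p̄, inr κ)` with `cp p̄ = Lc • p̄`, columns of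
the coarse system read by `(s, α) ↦ (s, inl α)`, slice rows by `id`): with `G₀ = 0` this is the displayed `h2` of the graded door at the sym tables. -/
theorem torus_h2_record_comb (j : ℕ) (hM' : ∀ i, Lc ∣ M' i)
    (cp : ↥(pbox M') → ↥(pbox (fine Lc M'))) (hcp : ∀ p : ↥(pbox M'), (cp p : Site (d + 1)) = (Lc : ℤ) • (p : Site (d + 1)))
    (hfμ : Function.Injective (fun a : ↥(pbox M') × Fin (d + 1) => ((cp a.1, Sum.inr a.2) : Idx (fine Lc M') (Fib d))))
    (hcoarse : ∀ (s : ↥(pbox (fine Lc M'))) (m : Fin (d + 1)),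
      ((s, Sum.inr m) : Idx (fine Lc M') (Fib d)) ∈ Set.range (fun a : ↥(pbox M') × Fin (d + 1) => ((cp a.1, Sum.inr a.2) : Idx (fine Lc M') (Fib d)))
        ↔ Torus.proj Lc (s : Site (d + 1)) = 0)
    {κ : Type*} [Fintype κ] [DecidableEq κ] (fμ' : κ → Idx M' (Fib d)) (hfμ' : Function.Injective fμ')
    (hμ' : ∀ a : κ, ∃ m : Fin (d + 1), (fμ' a).2 = Sum.inr m)
    (hcoarse' : ∀ (s : ↥(pbox M')) (m : Fin (d + 1)), ((s, Sum.inr m) : Idx M' (Fib d)) ∈ Set.range fμ' ↔ Torus.proj Lc (s : Site (d + 1)) = 0) :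
    (kkt
      (effForm ((perF (fine Lc M') (bhKStepSh d Lc (Dsh Lc) j)).submatrix
            (fun b : ↥(pbox (fine Lc M')) × Fin (d + 1) => ((b.1, Sum.inl b.2) : Idx (fine Lc M') (Fib d)))
            (fun b : ↥(pbox (fine Lc M')) × Fin (d + 1) => ((b.1, Sum.inl b.2) : Idx (fine Lc M') (Fib d))))
          (fromRows
            ((perF (fine Lc M') (bhKStepSh d Lc (Dsh Lc) j)).submatrix
              (fun a : ↥(pbox M') × Fin (d + 1) => ((cp a.1, Sum.inr a.2) : Idx (fine Lc M') (Fib d)))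
              (fun b : ↥(pbox (fine Lc M')) × Fin (d + 1) => ((b.1, Sum.inl b.2) : Idx (fine Lc M') (Fib d))))
            ((combRowsT (ctr (d + 1) Lc) Lc (fine Lc M')).submatrix id
              (fun b : ↥(pbox (fine Lc M')) × Fin (d + 1) => ((b.1, Sum.inl b.2) : Idx (fine Lc M') (Fib d)))))).toBlocks₁₁
      (fromRows
        ((perF M' (bhKStepSh d Lc (Dsh Lc) (j + 1))).submatrix fμ' (fun b : ↥(pbox M') × Fin (d + 1) => ((b.1, Sum.inl b.2) : Idx M' (Fib d))))
        ((combRowsT (ctr (d + 1) Lc) Lc M').submatrix id (fun b : ↥(pbox M') × Fin (d + 1) => ((b.1, Sum.inl b.2) : Idx M' (Fib d)))))).det ≠ 0 :=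
  torus_h2_comb M' j hM' (fun a : ↥(pbox M') × Fin (d + 1) => ((cp a.1, Sum.inr a.2) : Idx (fine Lc M') (Fib d))) hfμ (fun a => ⟨a.2, rfl⟩) hcoarse id
    (fun a => ⟨hcp a.1, rfl⟩) Function.bijective_id fμ' hfμ' hμ' hcoarse'

end Identification

end Summit.QuantumFields.BalabanUV.Beta.FP.RelInvPeriodisedCombRecord

end
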